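import Literature.NumberTheory.Weil1965.ThetaIntegralHermNormSplit
import Literature.NumberTheory.Automorphic.AdelePlacesIdempotent
import HarnessLib

/-!
# H413 · E-2 · SW2 (iii) — the hermitian norm `hNorm` ALONG THE PLACE SPLITTING `X□(𝔸_F) = X□(F_v) × X□(𝔸_F)^{(v)}`

Cell `hodgecm-mathlib`, crux H413 (`stmt-HodgeConjecture-24833`), child line `Cruxes/H413/Lines/F0_E2SiegelWeilWeilRange.lean`,
`StubSW2` (iii); the split-place packet of ★ `Theorems/H413E2SWSplitPlaceFrame*` ∕ `…Letters*` ∕ `…TorusIdele`.  PROOF lane,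
`--supports stmt-HodgeConjecture-24833 --as helper`.  HC_CM is proved only modulo the 7 printed citations until rung 0 closes;
nothing in this file is about Hodge classes.

THE TWO «CM LETTERS» `hadd` ∕ `hloc` of the (S-3E) brick «`E_X` does not charge the frame hyperplanes»
(`Weil1965/AdelicSiegelMeasureFrameHyperplane :: adelicSiegelMeasure_frameHyperplane_eq_zero`, generic in an invariant `h`),
AT `h := hNorm` (Weil's invariant `i_X` of the doubled carrier `X□(𝔸_F) = 𝔸_F^{n+n}`, ★ `ThetaIntegralOrbitFunctionalUnitary.hNorm`):
* `hNorm_single_add_of_mem` («`hadd`»): for `a ∈ F_v^{n+n}` and `y` TRIVIAL AT `v`,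
  `hNorm (single a + y) = hNorm (single a) + hNorm y` — the quadratic form `hNorm x = x¹ ⬝ᵥ 𝕋 x¹ − d (x² ⬝ᵥ 𝕋⁻¹ x²)`
  (★ `hNorm_eq_sub_dotProduct`) has no cross terms between the factor `X□(F_v)` (`single`, ★ `AdelicVectorPlaceSplitting`) and
  its complement `X□(𝔸_F)^{(v)}` (`trivialAt`): `ι_v(aᵢ) · z = ι_v(aᵢ z_v) = 0` when `z_v = 0` (★ `adeleSingleHom_mul`);
* `hNorm_single_eq_adeleSingleHom_adeleEval`: `hNorm (single a)` is SUPPORTED AT `v`, i.e. `= ι_v((hNorm (single a))_v)`;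
* `hNorm_single_eq_adeleSingleHom` («`hloc`», explicit): `hNorm (single a) = ι_v(a¹ ⬝ᵥ 𝕋_v a¹ − d (a² ⬝ᵥ 𝕋_v⁻¹ a²))`,
  `𝕋_v = gram ⊗ 1 ∈ M_n(F_v)` (★ `evalAt_hNorm`);
* `hNorm_single_eq_adeleSingleHom_dotProduct` («`hloc`» in the split coordinates): given split coordinates `β` at `v` with
  `(hNorm x)_v = (β x_v).1 ⬝ᵥ (β x_v).2` (the `hQ` clause of ★ `exists_splitPlaceFrame`, A-p01 (g13)),
  `hNorm (single a) = ι_v((β a).1 ⬝ᵥ (β a).2)`.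
So the CM corollary of (S-3E) is `adelicSiegelMeasure_frameHyperplane_eq_zero … (hadd := hNorm_single_add_of_mem …)
(hloc := hNorm_single_eq_adeleSingleHom_dotProduct … β hQ)`.  Weil (1965) n° 50 p. 74: at a place `v` of type (II) the
invariant is computed factor by factor, `i_X(x_v + x′) = i_X(x_v) + i_X(x′)` for `x′ ∈ X′ = ∏_{w ≠ v} X_w`.

## References
* [Weil1965] A. Weil, *Sur la formule de Siegel dans la théorie des groupes classiques*, Acta Math. 113 (1965) 1–87:
  Chap. IV n° 41 (35) p. 59 (the invariant `i_X`), Chap. V n° 50 pp. 73–74 (one place of type (II), `X_A = X_v × X′`).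
* [CasselsFrohlichANT1967] J. W. S. Cassels, A. Fröhlich (eds.), *Algebraic Number Theory* (1967), Ch. II §14 (`𝔸 = K_v × 𝔸^{(v)}`).
* [Bump1997] D. Bump, *Automorphic Forms and Representations* (1997), §3.3 Prop. 3.3.2.
-/

set_option autoImplicit false
-- the cell's `Summit.HodgeConjecture.HodgeConjecture.…` namespace repeats the summit name by design (D-0017 layout)
set_option linter.dupNamespace false

noncomputable section

namespace Summit.HodgeConjecture.HodgeConjecture.Cruxes.H413.E2SWSplitPlaceFrame

open scoped Matrix
open NumberField IsDedekindDomain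
open Literature.NumberTheory.Weil1965 Literature.NumberTheory.Weil1965.UnitaryDoubling
open Literature.NumberTheory.Automorphic
open Literature.NumberTheory.GelbartRogawski1991 Literature.NumberTheory.GelbartRogawski1991.UnitaryDualPair
open Literature.NumberTheory.Automorphic.AdelicVector (evalAt evalAt_apply trivialAt single evalAt_single single_apply
  mem_trivialAt_iff mulVec_mem_trivialAt)

/-! ## §1 Adele bookkeeping: products of a `v`-supported coordinate with a coordinate vanishing at `v` -/

section Support

variable (F : Type) [Field F] [NumberField F] (v : HeightOneSpectrum (𝓞 F))

/-- `ι_v(b) ⬝ᵥ w = 0` when every coordinate of `w` vanishes at `v` (`ι_v(bᵢ) wᵢ = ι_v(bᵢ (wᵢ)_v) = 0`).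
[cite: CasselsFrohlichANT1967, Ch. II §14] -/
theorem dotProduct_single_eq_zero_of_eval_eq_zero {m : ℕ} (b : Fin m → v.adicCompletion F)
    (w : Fin m → AdeleRing (𝓞 F) F) (hw : ∀ i, AdelicGroupData.adeleEval F v (w i) = 0) :
    (fun i => adeleSingleHom F v (b i)) ⬝ᵥ w = 0 := by
  refine Finset.sum_eq_zero fun i _ => ?_
  rw [adeleSingleHom_mul, hw i, mul_zero, map_zero]

/-- `w ⬝ᵥ ι_v(b) = 0` when every coordinate of `w` vanishes at `v`. [cite: CasselsFrohlichANT1967, Ch. II §14] -/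
theorem dotProduct_eq_zero_of_eval_eq_zero_single {m : ℕ} (w : Fin m → AdeleRing (𝓞 F) F)
    (hw : ∀ i, AdelicGroupData.adeleEval F v (w i) = 0) (b : Fin m → v.adicCompletion F) :
    w ⬝ᵥ (fun i => adeleSingleHom F v (b i)) = 0 := by
  rw [dotProduct_comm]
  exact dotProduct_single_eq_zero_of_eval_eq_zero F v b w hw

/-- **`ι_v(b) ⬝ᵥ M ι_v(b′) = ι_v(b ⬝ᵥ M_v b′)`**: a bilinear form of two `v`-supported vectors is the `v`-supported adele of
its `v`-component (`M_v = M.map (adeleEval v)`; `ι_v` is a non-unital ring homomorphism with `ι_v(x) a = ι_v(x a_v)`).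
[cite: CasselsFrohlichANT1967, Ch. II §14] -/
theorem single_dotProduct_mulVec_single {m : ℕ} (b b' : Fin m → v.adicCompletion F)
    (M : Matrix (Fin m) (Fin m) (AdeleRing (𝓞 F) F)) :
    (fun i => adeleSingleHom F v (b i)) ⬝ᵥ M *ᵥ (fun i => adeleSingleHom F v (b' i)) =
      adeleSingleHom F v (b ⬝ᵥ M.map (AdelicGroupData.adeleEval F v) *ᵥ b') := by
  have hw : (⇑(AdelicGroupData.adeleEval F v) ∘ fun j => adeleSingleHom F v (b' j)) = b' :=
    funext fun j => adeleEval_adeleSingleHom F v (b' j)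
  have hev : ∀ i, AdelicGroupData.adeleEval F v ((M *ᵥ fun j => adeleSingleHom F v (b' j)) i) =
      (M.map (AdelicGroupData.adeleEval F v) *ᵥ b') i := fun i => by
    -- `(M *ᵥ ι b')ᵢ` read at `v` is `(M_v *ᵥ (ι b')_v)ᵢ = (M_v *ᵥ b')ᵢ`
    rw [RingHom.map_mulVec (AdelicGroupData.adeleEval F v) M (fun j => adeleSingleHom F v (b' j)) i, hw]
  calc (fun i => adeleSingleHom F v (b i)) ⬝ᵥ M *ᵥ (fun i => adeleSingleHom F v (b' i))
      = ∑ i, adeleSingleHom F v (b i * (M.map (AdelicGroupData.adeleEval F v) *ᵥ b') i) := by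
        refine Finset.sum_congr rfl fun i _ => ?_
        rw [adeleSingleHom_mul, hev i]
    _ = adeleSingleHom F v (∑ i, b i * (M.map (AdelicGroupData.adeleEval F v) *ᵥ b') i) :=
        (map_sum (adeleSingleHom F v) _ _).symm
    _ = adeleSingleHom F v (b ⬝ᵥ M.map (AdelicGroupData.adeleEval F v) *ᵥ b') := rfl

/-- a principal adele times a `v`-supported adele: `d · ι_v(z) = ι_v(d z)`. [cite: CasselsFrohlichANT1967, Ch. II §14] -/
theorem algebraMap_mul_adeleSingleHom (d : F) (z : v.adicCompletion F) :
    algebraMap F (AdeleRing (𝓞 F) F) d * adeleSingleHom F v z =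
      adeleSingleHom F v (algebraMap F (v.adicCompletion F) d * z) := by
  -- `(d ⊗ 1)_v = d` (definitional: the finite part of a principal adele is the diagonal embedding)
  rw [mul_adeleSingleHom]
  rfl

/-- an adele of the form `ι_v(z)` is recovered from its `v`-component: `ι_v((ι_v z)_v) = ι_v z`. [cite: CasselsFrohlichANT1967, Ch. II §14] -/
theorem adeleSingleHom_adeleEval_adeleSingleHom (z : v.adicCompletion F) :
    adeleSingleHom F v (AdelicGroupData.adeleEval F v (adeleSingleHom F v z)) = adeleSingleHom F v z := by
  rw [adeleEval_adeleSingleHom]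

end Support

/-! ## §2 `hNorm` along `X□(𝔸_F) = X□(F_v) × X□(𝔸_F)^{(v)}` -/

section HNorm

variable (F E : Type) [Field F] [NumberField F] [Field E] [NumberField E] [Algebra F E] [Algebra.IsQuadraticExtension F E]
  (c : E ≃ₐ[F] E) {δ : E} (hcδ : c δ = -δ) (hδ : δ ≠ 0) {d : F} (hd : δ * δ = algebraMap F E d)
  (N : ℕ) {n : ℕ} (e : Fin N × Fin 1 ≃ Fin n)
  (TV : Matrix (Fin N) (Fin N) F) (hVd : IsUnit TV.det)
  (TW : Matrix (Fin 1) (Fin 1) F) (hWd : IsUnit TW.det)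
  (v : HeightOneSpectrum (𝓞 F))

/-- the first half `x¹ = x ∘ Fin.castAdd n` of a vector trivial at `v` vanishes at `v` coordinatewise. [folklore] -/
private theorem eval_castAdd_eq_zero_of_mem {y : Fin (n + n) → AdeleRing (𝓞 F) F} (hy : y ∈ trivialAt F (Fin (n + n)) v)
    (i : Fin n) : AdelicGroupData.adeleEval F v (y (Fin.castAdd n i)) = 0 :=
  (mem_trivialAt_iff.1 hy) (Fin.castAdd n i)

/-- the second half `x² = x ∘ Fin.natAdd n` of a vector trivial at `v` vanishes at `v` coordinatewise. [folklore] -/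
private theorem eval_natAdd_eq_zero_of_mem {y : Fin (n + n) → AdeleRing (𝓞 F) F} (hy : y ∈ trivialAt F (Fin (n + n)) v)
    (i : Fin n) : AdelicGroupData.adeleEval F v (y (Fin.natAdd n i)) = 0 :=
  (mem_trivialAt_iff.1 hy) (Fin.natAdd n i)

/-- a sub-vector of a vector trivial at `v` is trivial at `v`, hence so is its image under any adelic matrix. [folklore] -/
private theorem eval_mulVec_eq_zero_of_eval_eq_zero {m : ℕ} (M : Matrix (Fin m) (Fin m) (AdeleRing (𝓞 F) F))
    {w : Fin m → AdeleRing (𝓞 F) F} (hw : ∀ i, AdelicGroupData.adeleEval F v (w i) = 0) (i : Fin m) :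
    AdelicGroupData.adeleEval F v ((M *ᵥ w) i) = 0 := by
  have hmem : w ∈ trivialAt F (Fin m) v := mem_trivialAt_iff.2 hw
  exact (mem_trivialAt_iff.1 (mulVec_mem_trivialAt M hmem)) i

/-- the CROSS TERMS VANISH: `ι_v(b) ⬝ᵥ M w = 0` and `w ⬝ᵥ M ι_v(b) = 0` for `w` vanishing at `v`. [cite: CasselsFrohlichANT1967, Ch. II §14] -/
private theorem cross_terms_eq_zero {m : ℕ} (M : Matrix (Fin m) (Fin m) (AdeleRing (𝓞 F) F))
    (b : Fin m → v.adicCompletion F) {w : Fin m → AdeleRing (𝓞 F) F}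
    (hw : ∀ i, AdelicGroupData.adeleEval F v (w i) = 0) :
    (fun i => adeleSingleHom F v (b i)) ⬝ᵥ M *ᵥ w = 0 ∧ w ⬝ᵥ M *ᵥ (fun i => adeleSingleHom F v (b i)) = 0 := by
  refine ⟨dotProduct_single_eq_zero_of_eval_eq_zero F v b _ (eval_mulVec_eq_zero_of_eval_eq_zero F v M hw), ?_⟩
  rw [Matrix.dotProduct_mulVec, ← Matrix.mulVec_transpose]
  exact dotProduct_eq_zero_of_eval_eq_zero_single F v _ (eval_mulVec_eq_zero_of_eval_eq_zero F v Mᵀ hw) b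

include hd in
/-- **`hadd` — NO CROSS TERMS ACROSS THE PLACE SPLITTING**: for `a ∈ X□(F_v)` and `y ∈ X□(𝔸_F)^{(v)}` (trivial at `v`),
`hNorm (single a + y) = hNorm (single a) + hNorm y`.  Weil's `i_X` is a quadratic form over `𝔸_F = F_v × 𝔸_F^{(v)}`, and
`F_v · 𝔸_F^{(v)} = 0` inside `𝔸_F`. [cite: Weil1965, Chap. V n° 50, pp. 73–74] -/
theorem hNorm_single_add_of_mem (a : Fin (n + n) → v.adicCompletion F) {y : Fin (n + n) → AdeleRing (𝓞 F) F}
    (hy : y ∈ trivialAt F (Fin (n + n)) v) :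
    hNorm F E c hcδ hδ N e TV hVd TW hWd (single F (Fin (n + n)) v a + y) =
      hNorm F E c hcδ hδ N e TV hVd TW hWd (single F (Fin (n + n)) v a) + hNorm F E c hcδ hδ N e TV hVd TW hWd y := by
  -- names: `𝕋`, the two halves of `single a` (as `ι_v`-vectors) and of `y`
  set T : Matrix (Fin n) (Fin n) (AdeleRing (𝓞 F) F) := adelicGram F e TV TW with hT
  have hu1 : (fun i => (single F (Fin (n + n)) v a) (Fin.castAdd n i)) = fun i => adeleSingleHom F v (a (Fin.castAdd n i)) :=
    rfl
  have hu2 : (fun i => (single F (Fin (n + n)) v a) (Fin.natAdd n i)) = fun i => adeleSingleHom F v (a (Fin.natAdd n i)) :=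
    rfl
  have hs1 : (fun i => (single F (Fin (n + n)) v a + y) (Fin.castAdd n i)) =
      (fun i => adeleSingleHom F v (a (Fin.castAdd n i))) + fun i => y (Fin.castAdd n i) := rfl
  have hs2 : (fun i => (single F (Fin (n + n)) v a + y) (Fin.natAdd n i)) =
      (fun i => adeleSingleHom F v (a (Fin.natAdd n i))) + fun i => y (Fin.natAdd n i) := rfl
  -- the four cross terms vanish
  obtain ⟨c11, c12⟩ := cross_terms_eq_zero F v T (fun i => a (Fin.castAdd n i)) (eval_castAdd_eq_zero_of_mem F v hy)
  obtain ⟨c21, c22⟩ := cross_terms_eq_zero F v T⁻¹ (fun i => a (Fin.natAdd n i)) (eval_natAdd_eq_zero_of_mem F v hy)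
  rw [hNorm_eq_sub_dotProduct F E c hcδ hδ hd N e TV hVd TW hWd, hNorm_eq_sub_dotProduct F E c hcδ hδ hd N e TV hVd TW hWd,
    hNorm_eq_sub_dotProduct F E c hcδ hδ hd N e TV hVd TW hWd, ← hT, hs1, hs2, hu1, hu2]
  simp only [Matrix.mulVec_add, add_dotProduct, dotProduct_add, c11, c12, c21, c22, add_zero, zero_add]
  ring

include hd in
/-- **`hNorm` OF A `v`-SUPPORTED VECTOR IS `v`-SUPPORTED**: `hNorm (single a) = ι_v((hNorm (single a))_v)`.
[cite: Weil1965, Chap. V n° 50, pp. 73–74] -/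
theorem hNorm_single_eq_adeleSingleHom_adeleEval (a : Fin (n + n) → v.adicCompletion F) :
    hNorm F E c hcδ hδ N e TV hVd TW hWd (single F (Fin (n + n)) v a) =
      adeleSingleHom F v (AdelicGroupData.adeleEval F v (hNorm F E c hcδ hδ N e TV hVd TW hWd (single F (Fin (n + n)) v a))) := by
  set T : Matrix (Fin n) (Fin n) (AdeleRing (𝓞 F) F) := adelicGram F e TV TW with hT
  have hu1 : (fun i => (single F (Fin (n + n)) v a) (Fin.castAdd n i)) = fun i => adeleSingleHom F v (a (Fin.castAdd n i)) :=
    rfl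
  have hu2 : (fun i => (single F (Fin (n + n)) v a) (Fin.natAdd n i)) = fun i => adeleSingleHom F v (a (Fin.natAdd n i)) :=
    rfl
  rw [hNorm_eq_sub_dotProduct F E c hcδ hδ hd N e TV hVd TW hWd, ← hT, hu1, hu2,
    single_dotProduct_mulVec_single F v, single_dotProduct_mulVec_single F v, algebraMap_mul_adeleSingleHom F v,
    ← map_sub, adeleEval_adeleSingleHom]

include hd in
/-- **`hloc` (explicit) — THE `v`-FACTOR OF THE INVARIANT**: with `a¹ = a ∘ Fin.castAdd n`, `a² = a ∘ Fin.natAdd n` and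
`𝕋_v = gram ⊗ 1 ∈ M_n(F_v)`, `hNorm (single a) = ι_v(a¹ ⬝ᵥ 𝕋_v a¹ − d · (a² ⬝ᵥ 𝕋_v⁻¹ a²))`.
[cite: Weil1965, Chap. IV n° 41, (35) p. 59] -/
theorem hNorm_single_eq_adeleSingleHom (a : Fin (n + n) → v.adicCompletion F) :
    hNorm F E c hcδ hδ N e TV hVd TW hWd (single F (Fin (n + n)) v a) =
      adeleSingleHom F v
        ((fun i => a (Fin.castAdd n i)) ⬝ᵥ
            (UnitaryDualPair.gram F e TV TW).map (algebraMap F (v.adicCompletion F)) *ᵥ (fun i => a (Fin.castAdd n i)) -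
          algebraMap F (v.adicCompletion F) d *
            ((fun i => a (Fin.natAdd n i)) ⬝ᵥ
              ((UnitaryDualPair.gram F e TV TW).map (algebraMap F (v.adicCompletion F)))⁻¹ *ᵥ (fun i => a (Fin.natAdd n i)))) := by
  rw [hNorm_single_eq_adeleSingleHom_adeleEval F E c hcδ hδ hd N e TV hVd TW hWd v a,
    evalAt_hNorm F E c hcδ hδ hd N e TV hVd TW hWd v]
  congr 1
  have h : evalAt F (Fin (n + n)) v (single F (Fin (n + n)) v a) = a := evalAt_single a
  simp only [h]

include hd in
/-- **`hloc` IN SPLIT COORDINATES**: if `β` are split coordinates at `v` reading the invariant as the split form,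
`(hNorm x)_v = (β x_v).1 ⬝ᵥ (β x_v).2` (the `hQ` clause of the split-place frame), then
`hNorm (single a) = ι_v((β a).1 ⬝ᵥ (β a).2)`. [cite: Weil1965, Chap. V n° 50, pp. 73–74] -/
theorem hNorm_single_eq_adeleSingleHom_dotProduct {κ : Type*}
    (β : (Fin (n + n) → v.adicCompletion F) → (κ → v.adicCompletion F) × (κ → v.adicCompletion F)) [Fintype κ]
    (hQ : ∀ x : Fin (n + n) → AdeleRing (𝓞 F) F,
      AdelicGroupData.adeleEval F v (hNorm F E c hcδ hδ N e TV hVd TW hWd x) =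
        (β (evalAt F (Fin (n + n)) v x)).1 ⬝ᵥ (β (evalAt F (Fin (n + n)) v x)).2)
    (a : Fin (n + n) → v.adicCompletion F) :
    hNorm F E c hcδ hδ N e TV hVd TW hWd (single F (Fin (n + n)) v a) = adeleSingleHom F v ((β a).1 ⬝ᵥ (β a).2) := by
  rw [hNorm_single_eq_adeleSingleHom_adeleEval F E c hcδ hδ hd N e TV hVd TW hWd v a, hQ, evalAt_single]

include hd in
/-- **`hloc` FOR THE SPLIT COORDINATES GIVEN BY THEIR FORMULA** `β y = (y¹ + s 𝕋_v⁻¹ y², 𝕋_v y¹ − s y²)`, `s² = d`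
(the first clause of ★ `exists_splitPlaceSelector₃` ∕ ★ `exists_splitPlaceFrame₃`, A-p01 (g13); ★ `exists_splitBeta_adicCompletion`):
`hNorm (single a) = ι_v((β a).1 ⬝ᵥ (β a).2)` — the identity `(a¹ + s𝕋_v⁻¹a²) ⬝ᵥ (𝕋_v a¹ − s a²) = a¹ ⬝ᵥ 𝕋_v a¹ − d (a² ⬝ᵥ 𝕋_v⁻¹ a²)`
for the symmetric invertible `𝕋_v`. [cite: Weil1965, Chap. II n° 21–23, pp. 32–36] -/
theorem hNorm_single_eq_adeleSingleHom_dotProduct_of_formula (hV : TV.IsSymm) (hW : TW.IsSymm)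
    {s : v.adicCompletion F} (hs : s * s = algebraMap F (v.adicCompletion F) d)
    (β : (Fin (n + n) → v.adicCompletion F) → (Fin n → v.adicCompletion F) × (Fin n → v.adicCompletion F))
    (hβ : ∀ y, β y =
      ((fun i => y (Fin.castAdd n i)) +
          s • ((UnitaryDualPair.gram F e TV TW).map (algebraMap F (v.adicCompletion F)))⁻¹ *ᵥ (fun i => y (Fin.natAdd n i)),
        (UnitaryDualPair.gram F e TV TW).map (algebraMap F (v.adicCompletion F)) *ᵥ (fun i => y (Fin.castAdd n i)) -
          s • (fun i => y (Fin.natAdd n i))))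
    (a : Fin (n + n) → v.adicCompletion F) :
    hNorm F E c hcδ hδ N e TV hVd TW hWd (single F (Fin (n + n)) v a) = adeleSingleHom F v ((β a).1 ⬝ᵥ (β a).2) := by
  set G : Matrix (Fin n) (Fin n) (v.adicCompletion F) :=
    (UnitaryDualPair.gram F e TV TW).map (algebraMap F (v.adicCompletion F)) with hG
  set a1 : Fin n → v.adicCompletion F := fun i => a (Fin.castAdd n i) with ha1
  set a2 : Fin n → v.adicCompletion F := fun i => a (Fin.natAdd n i) with ha2
  have hGs : Gᵀ = G := isSymm_gram_map F N e TV hV TW hW v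
  have hGi : G * G⁻¹ = 1 := Matrix.mul_nonsing_inv G (isUnit_det_gram_map F N e TV hVd TW hWd v)
  -- `(𝕋_v⁻¹ a²) ⬝ᵥ (𝕋_v a¹) = a¹ ⬝ᵥ a²` (symmetry) and `(𝕋_v⁻¹ a²) ⬝ᵥ a² = a² ⬝ᵥ 𝕋_v⁻¹ a²`
  have hkey : (G⁻¹ *ᵥ a2) ⬝ᵥ (G *ᵥ a1) = a1 ⬝ᵥ a2 := by
    calc (G⁻¹ *ᵥ a2) ⬝ᵥ (G *ᵥ a1) = ((G⁻¹ *ᵥ a2) ᵥ* G) ⬝ᵥ a1 := Matrix.dotProduct_mulVec _ _ _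
      _ = (Gᵀ *ᵥ (G⁻¹ *ᵥ a2)) ⬝ᵥ a1 := by rw [Matrix.mulVec_transpose]
      _ = a2 ⬝ᵥ a1 := by rw [hGs, Matrix.mulVec_mulVec, hGi, Matrix.one_mulVec]
      _ = a1 ⬝ᵥ a2 := dotProduct_comm _ _
  have hcomm : (G⁻¹ *ᵥ a2) ⬝ᵥ a2 = a2 ⬝ᵥ (G⁻¹ *ᵥ a2) := dotProduct_comm _ _
  rw [hNorm_single_eq_adeleSingleHom F E c hcδ hδ hd N e TV hVd TW hWd v a, hβ a, ← hG, ← ha1, ← ha2]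
  congr 1
  simp only [add_dotProduct, dotProduct_sub, smul_dotProduct, dotProduct_smul, smul_eq_mul, hkey, hcomm, ← hs]
  ring

include hd in
/-- **THE PLACE-SPLITTING FORM OF `hNorm`**: for every `x ∈ X□(𝔸_F)`, writing `x = single x_v + x′` with `x′` trivial at `v`
(★ `placeSplitting`), `hNorm x = ι_v((hNorm x)_v) + hNorm x′`. [cite: Weil1965, Chap. V n° 50, pp. 73–74] -/
theorem hNorm_eq_adeleSingleHom_add_of_sub_mem (x : Fin (n + n) → AdeleRing (𝓞 F) F) {y : Fin (n + n) → AdeleRing (𝓞 F) F}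
    (hy : y ∈ trivialAt F (Fin (n + n)) v) (hx : x = single F (Fin (n + n)) v (evalAt F (Fin (n + n)) v x) + y) :
    hNorm F E c hcδ hδ N e TV hVd TW hWd x =
      adeleSingleHom F v (AdelicGroupData.adeleEval F v (hNorm F E c hcδ hδ N e TV hVd TW hWd x)) +
        hNorm F E c hcδ hδ N e TV hVd TW hWd y := by
  -- `(hNorm y)_v = 0`: the `v`-component of the invariant of a vector trivial at `v`
  have hyv : AdelicGroupData.adeleEval F v (hNorm F E c hcδ hδ N e TV hVd TW hWd y) = 0 := by
    rw [evalAt_hNorm F E c hcδ hδ hd N e TV hVd TW hWd v y]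
    have h0 : evalAt F (Fin (n + n)) v y = 0 := Literature.NumberTheory.Automorphic.AdelicVector.evalAt_eq_zero_of_mem hy
    have h1 : (fun i => evalAt F (Fin (n + n)) v y (Fin.castAdd n i)) = 0 := funext fun i => by rw [h0]; rfl
    have h2 : (fun i => evalAt F (Fin (n + n)) v y (Fin.natAdd n i)) = 0 := funext fun i => by rw [h0]; rfl
    rw [h1, h2, Matrix.mulVec_zero, Matrix.mulVec_zero, dotProduct_zero, mul_zero, sub_zero]
  have key : ∀ a : Fin (n + n) → v.adicCompletion F,
      hNorm F E c hcδ hδ N e TV hVd TW hWd (single F (Fin (n + n)) v a + y) =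
        adeleSingleHom F v (AdelicGroupData.adeleEval F v
          (hNorm F E c hcδ hδ N e TV hVd TW hWd (single F (Fin (n + n)) v a + y))) +
          hNorm F E c hcδ hδ N e TV hVd TW hWd y := fun a => by
    rw [hNorm_single_add_of_mem F E c hcδ hδ hd N e TV hVd TW hWd v a hy, map_add, hyv, add_zero,
      ← hNorm_single_eq_adeleSingleHom_adeleEval F E c hcδ hδ hd N e TV hVd TW hWd v a]
  rw [hx]
  exact key _

end HNorm

end Summit.HodgeConjecture.HodgeConjecture.Cruxes.H413.E2SWSplitPlaceFrame
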